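import Summits.QuantumFields.YangMills.Theorems.PencilRigidityDiagonalMirrorRPRStubRpClosureOffDiag
import Literature.MathematicalPhysics.QuantumFieldTheory.WilsonAxisSymmetry
import HarnessLib

/-!
# Crux `WeakCouplingHypercubicLimitRP` (stmt-QuantumFields-27398), line `Sketch`, stub D1 `stub_diagRPOfPlaneLimits`:
# (PSD) in a canonical diagonal frame from the own-torus swap socket (file 1 of 2 of the D1 transfer)

Helper file (`--supports stmt-QuantumFields-27398`) of the crux lead `lead-27398-D1` for the registered stub D1
`stub_diagRPOfPlaneLimits` of `Cruxes/WeakCouplingHypercubicLimitRP/Lines/Sketch.lean` (sha16 `7bf38c709623ad77`):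
`… → PlaneLimits r sch φ T → DiagonalFrameRP (planeSum T)`.  The companion file
`…WeakCouplingHypercubicLimitRPDiagRPOfSwapPairing.lean` finishes the transfer (frame reduction, density closure, the D1 corollary).

HONEST FRAMING.  Nothing here closes D1, the crux ⟨27398⟩ or its heart S6i; the Yang–Mills mass gap is NOT proved here or
anywhere in the tree.  The two files prove the CONTINUUM HALF of D1 unconditionally: D1 follows from the LATTICE statement
D1′ «the swap-mirror Gram pairings of compact half-space curvature products on the witness's OWN odd tori have `liminf_k ≥ 0`
along the subsequence» — the socket `OddTorusSwapPairingLiminf r (subseq sch φ hφ)` of the door-B core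
(`Cruxes/DiagonalMirrorRPR/Lines/sign_twisted_diagonal_trace_core.lean`, concluded there by `core_of` from the letters
`OddTwistGap`/`DiagLukewarm`/`Growth`) and equally of door C (`pairingLiminf_of_cube`).  The socket's body is stated VERBATIM
as a hypothesis (its `def` lives in a `Cruxes/` workfile, not importable under `Theorems/`).

## Contents

* §1 Lattice symmetry (the new ingredient).  On the scheme's own torus the curvature `n`-point function is invariant under the
  coordinate swap `x₀ ↔ x₁` of all test functions (`latticeSchwinger_swap`: Wilson's torus measure is `configPerm`-invariant,
  `integral_comp_configPerm_wilsonMeasure`, and the curvature at the swapped corner of the lift of the swapped configuration is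
  the curvature at the corner, `LatticeRep.curvature_F_perm_torusLift`) and under re-indexing (`latticeSchwinger_comp_equiv`);
  hence the swap Gram matrix `⟨∏Φ(σf_I) ∏Φ(f_J)⟩_k` of a mirrored family is SYMMETRIC at every `k`
  (`latticeSchwinger_append_mirror_symm`, via `Fin.append_rev`).  This is what turns the socket — typed for REAL coefficient
  vectors — into the Hermitian statement E2 needs (`im z = 0` IS the symmetry).
* §2 (PSD) in a canonical frame `R e₀ = c (e₀ − e₁)` from the socket (`psd_canonical_ofSwapPairing`): the landed
  `RpClosure.psd_canonical` (p87246–p94527) with cover swap-RP + cover insensitivity REPLACED by the socket: entries of the OS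
  Gram matrix of slab-ordered compact real products in the frame are limits (`hconv` on the own torus; degree `0` by E0 and
  `⟨1⟩ = 1`) of the own-torus swap Gram matrix of the frame-rotated factors (`linActTest_thetaTest_apply`: the reflected factor
  is the swapped factor; supports in `{x₁ < x₀}` by `frame_time`, pairwise disjoint by `disjoint_tsupport_linActTest_of_slabs`);
  the limit matrix is real (limits of reals) and symmetric (§1), its real quadratic form is `≥ 0` (socket + convergence ⇒
  `lim = liminf ≥ 0`), so the Hermitian form at complex coefficients is `q(Re c) + q(Im c) ≥ 0` with vanishing imaginary part.

References: Osterwalder–Schrader, Comm. Math. Phys. 31 (1973) §2–3 (E2 on `𝒮_<`); Osterwalder–Seiler, Ann. Phys. 110 (1978)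
§2–3; Fröhlich–Israel–Lieb–Simon, Comm. Math. Phys. 62 (1978) Thm 2.1; Glimm–Jaffe, *Quantum Physics* §6.1; E. Seiler, LNP 159
(1982) Ch. 1–2 (hypercubic invariance of Wilson's action and measure).
-/

set_option autoImplicit false

noncomputable section

open scoped SchwartzMap ComplexConjugate InnerProductSpace
open MeasureTheory Filter Topology
open Literature.MathematicalPhysics.QuantumLattice Literature.MathematicalPhysics.AQFT
  Literature.MathematicalPhysics.QuantumFieldTheory
open Literature.Probability.LatticeModels (box Site)

namespace Summit.QuantumFields.YangMills.Cruxes.DiagonalMirrorRPR.ParityBridgeColdTraces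

namespace RpClosure

/-! ## §1 Lattice symmetry: the own-torus swap Gram matrix of a mirrored family is symmetric -/

section LatticeSwap

variable {G : Type} [Group G] [TopologicalSpace G] [IsTopologicalGroup G] [CompactSpace G]
  [MeasurableSpace G] [BorelSpace G] (r : LatticeRep G) (sch : SpeciesScheme (YMSpecies G))

/-- **Re-indexing.** The curvature `n`-point function of a scheme is invariant under re-indexing the string of test
functions along an equivalence of index types (the integrand is a finite product). -/
theorem latticeSchwinger_comp_equiv (k : ℕ) {n n' : ℕ} (e : Fin n ≃ Fin n') (u : Fin n' → 𝓢(E4, ℝ)) :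
    latticeSchwinger r.ρ sch (fun s => s.F) k n (fun _ => r.curvature) (u ∘ e) =
      latticeSchwinger r.ρ sch (fun s => s.F) k n' (fun _ => r.curvature) u := by
  unfold latticeSchwinger
  congr 1
  funext U
  exact Fintype.prod_equiv e _ _ fun i => rfl

/-- The site swap `x₀ ↔ x₁` of `ℤ⁴` is the coordinate permutation `sitePermZd (0 1)`. -/
theorem siteSwap_eq_sitePermZd (y : Site 4) : siteSwap y = sitePermZd (Equiv.swap (0 : Fin 4) 1) y := by
  funext j
  simp [siteSwap, sitePermZd_apply, Equiv.symm_swap]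

/-- The coordinate swap of `ℝ⁴` is an involution. -/
theorem swap01_swap01 (x : E4) : swap01 (swap01 x) = x := by
  ext i
  simp [swap01, PiLp.toLp_apply, Equiv.swap_apply_self]

/-- **Swap covariance on the own torus.** The curvature `n`-point function of the scheme at step `k` takes the same value on a
string of real test functions and on the string swapped by `x₀ ↔ x₁`: Wilson's torus measure is invariant under the axis
transposition (`integral_comp_configPerm_wilsonMeasure`), the smearing box is swap invariant, and the curvature at the swapped
corner of the periodic lift of the swapped configuration is the curvature at the corner (`LatticeRep.curvature_F_perm_torusLift`). -/
theorem latticeSchwinger_swap (k n : ℕ) (u u' : Fin n → 𝓢(E4, ℝ)) (h : ∀ p x, u' p x = u p (swap01 x)) :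
    latticeSchwinger r.ρ sch (fun s => s.F) k n (fun _ => r.curvature) u' =
      latticeSchwinger r.ρ sch (fun s => s.F) k n (fun _ => r.curvature) u := by
  unfold latticeSchwinger
  rw [← integral_comp_configPerm_wilsonMeasure r.ρ r.continuous (sch.β k) (Equiv.swap (0 : Fin 4) 1)
    (fun U : GaugeConfig 4 (sch.side k) G => ∏ i, smearedLatticeField ((fun s : YMSpecies G => s.F)
      ((fun _ : Fin n => r.curvature) i)) (box 4 (sch.L k)) (sch.a k) (sch.c ((fun _ : Fin n => r.curvature) i) k)
      (sch.m ((fun _ : Fin n => r.curvature) i) k) (u i) (torusLift (sch.side k) U))]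
  congr 1
  funext U
  refine Finset.prod_congr rfl fun i _ => ?_
  unfold smearedLatticeField
  congr 1
  refine Finset.sum_nbij' (sitePermZd (Equiv.swap (0 : Fin 4) 1)) (sitePermZd (Equiv.swap (0 : Fin 4) 1))
    (fun x hx => (sitePermZd_mem_box_iff _ _ x).2 hx) (fun x hx => (sitePermZd_mem_box_iff _ _ x).2 hx)
    (fun x _ => ?_) (fun x _ => ?_) (fun x _ => ?_)
  · funext j; simp [sitePermZd_apply]
  · funext j; simp [sitePermZd_apply]
  · dsimp only
    rw [h, swap01_smul_siteToE, siteSwap_eq_sitePermZd, LatticeRep.curvature_F_perm_torusLift]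

/-- **The own-torus swap Gram matrix of a mirrored family is symmetric.**  For real strings `f` (length `n`), `f'` (length `n'`)
with swap-mirrors `σf j = f (rev j) ∘ swap₀₁`, `σf' j = f' (rev j) ∘ swap₀₁`:
`⟨∏Φ(σf) ∏Φ(f')⟩_k = ⟨∏Φ(σf') ∏Φ(f)⟩_k` — swap every test function (`latticeSchwinger_swap`), then reverse the string
(`Fin.append_rev`, `latticeSchwinger_comp_equiv`). -/
theorem latticeSchwinger_append_mirror_symm (k : ℕ) {n n' : ℕ} (f σf : Fin n → 𝓢(E4, ℝ)) (f' σf' : Fin n' → 𝓢(E4, ℝ))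
    (hf : ∀ j x, σf j x = f (Fin.rev j) (swap01 x)) (hf' : ∀ j x, σf' j x = f' (Fin.rev j) (swap01 x)) :
    latticeSchwinger r.ρ sch (fun s => s.F) k (n + n') (fun _ => r.curvature) (Fin.append σf f') =
      latticeSchwinger r.ρ sch (fun s => s.F) k (n' + n) (fun _ => r.curvature) (Fin.append σf' f) := by
  have h1 : latticeSchwinger r.ρ sch (fun s => s.F) k (n + n') (fun _ => r.curvature) (Fin.append σf f') =
      latticeSchwinger r.ρ sch (fun s => s.F) k (n + n') (fun _ => r.curvature)
        (Fin.append (f ∘ Fin.rev) (σf' ∘ Fin.rev)) := by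
    refine latticeSchwinger_swap r sch k (n + n') _ _ fun p x => ?_
    induction p using Fin.addCases with
    | left j => simp only [Fin.append_left, Function.comp_apply]; exact hf j x
    | right j => simp only [Fin.append_right, Function.comp_apply]; rw [hf', Fin.rev_rev, swap01_swap01]
  have h2 : Fin.append (f ∘ Fin.rev) (σf' ∘ Fin.rev) =
      Fin.append σf' f ∘ ⇑((finCongr (Nat.add_comm n n')).trans Fin.revPerm) := by
    funext q
    simp only [Function.comp_apply, Equiv.trans_apply, finCongr_apply, Fin.revPerm_apply]
    rw [Fin.append_rev σf' f]
    simp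
  rw [h1, h2]
  exact latticeSchwinger_comp_equiv r sch k _ _

end LatticeSwap

/-! ## §2 (PSD) in a canonical frame from the own-torus swap socket -/

section PSD

variable {G : Type} [Group G] [TopologicalSpace G] [IsTopologicalGroup G] [CompactSpace G]
  [MeasurableSpace G] [BorelSpace G] (r : LatticeRep G) (sch : SpeciesScheme (YMSpecies G))
  {R : E4 ≃ₗᵢ[ℝ] E4} {c : ℝ}

/-- **(PSD) in a canonical frame, from the socket.**  For `R e₀ = c (e₀ − e₁)`, `c = 1/√2`, a family `S₁` with own-torus
convergence `hconv` on off-diagonal real tensors and E0, and the own-torus swap socket (real coefficients, `liminf ≥ 0`):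
for every finite family of slab-ordered compact real products `P_I` and complex coefficients `c_I`,
`∑_{I,J} c̄_I c_J 𝔖(R · (Θ P_I* ⊗ P_J)) ≥ 0` (real and non-negative). -/
theorem psd_canonical_ofSwapPairing (S₁ : SchwingerFamily E4)
    (hconv : ∀ (n : ℕ), n ≠ 0 → ∀ (f : Fin n → 𝓢(E4, ℝ)) (F : 𝓢((Fin n → E4), ℂ)),
      IsTensorOf F (fun i => ofRealTest (f i)) → IsOffDiagonal F →
        Tendsto (fun k : ℕ => ((latticeSchwinger r.ρ sch (fun s => s.F) k n (fun _ => r.curvature) f : ℝ) : ℂ))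
          atTop (𝓝 (S₁ n F)))
    (hE0 : S₁.toLabelled.IsNormalized)
    (hsock : ∀ (m : ℕ) (n : Fin m → ℕ) (c : Fin m → ℝ) (f σf : (i : Fin m) → Fin (n i) → 𝓢(E4, ℝ)),
      (∀ i j, HasCompactSupport (f i j : E4 → ℝ) ∧ tsupport (f i j : E4 → ℝ) ⊆ {x : E4 | x 1 < x 0}) →
      (∀ i (j j' : Fin (n i)), j ≠ j' → Disjoint (tsupport (f i j : E4 → ℝ)) (tsupport (f i j' : E4 → ℝ))) →
      (∀ i j (x : E4), σf i j x = f i (Fin.rev j) (swap01 x)) →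
        0 ≤ Filter.liminf (fun k : ℕ => ∑ i, ∑ i', c i * c i' *
          latticeSchwinger r.ρ sch (fun s => s.F) k (n i + n i') (fun _ => r.curvature)
            (Fin.append (σf i) (f i'))) atTop)
    (hc : c ^ 2 = 1 / 2) (hc0 : 0 < c) (hR : R (ee 0) = c • ee 0 + (-c) • ee 1) {ι : Type} [Fintype ι]
    (deg : ι → ℕ) (P : (I : ι) → 𝓢((Fin (deg I) → E4), ℂ))
    (hP : ∀ I, P I ∈ slabOrderedCompactProducts 4 (deg I)) (coef : ι → ℂ) :
    let z := ∑ I, ∑ J, conj (coef I) * coef J * (pullback S₁ R).osPairing (P I) (P J)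
    0 ≤ z.re ∧ z.im = 0 := by
  -- adapted from `psd_canonical` / `psd_canonical_offDiag` (…StubRpClosure §H, …StubRpClosureOffDiag §H'):
  -- the lattice PSD input is the own-torus socket instead of swap-RP on the cover
  intro z
  choose f lo hi hT hlo hle hord hsupp hcs using hP
  -- the frame-rotated factors and their swap mirrors
  let fs : (I : ι) → Fin (deg I) → 𝓢(E4, ℝ) := fun I l => linActTest R (f I l)
  let σfs : (I : ι) → Fin (deg I) → 𝓢(E4, ℝ) := fun I l => linActTest R (thetaTest 4 (f I (Fin.rev l)))
  have hmirror : ∀ I (l : Fin (deg I)) (x : E4), σfs I l x = fs I (Fin.rev l) (swap01 x) := fun I l x =>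
    linActTest_thetaTest_apply hR hc (f I (Fin.rev l)) x
  have hhalf : ∀ I (l : Fin (deg I)), tsupport (fs I l : E4 → ℝ) ⊆ {x : E4 | x 1 < x 0} := by
    intro I l x hx
    have h1 := hsupp I l (tsupport_linActTest_subset R (f I l) hx)
    simp only [Set.mem_setOf_eq, frame_time hR] at h1
    have h2 : 0 < c * (x 0 - x 1) := (hlo I l).trans_le h1.1
    exact sub_pos.1 ((mul_pos_iff_of_pos_left hc0).1 h2)
  have hdisj : ∀ I (l l' : Fin (deg I)), l ≠ l' →
      Disjoint (tsupport (fs I l : E4 → ℝ)) (tsupport (fs I l' : E4 → ℝ)) := fun I l l' hll' =>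
    disjoint_tsupport_linActTest_of_slabs (hord I) (hsupp I) R l l' hll'
  -- the own-torus swap Gram matrix and its limit
  let M : ℕ → ι → ι → ℝ := fun k I J =>
    latticeSchwinger r.ρ sch (fun s => s.F) k (deg I + deg J) (fun _ => r.curvature) (Fin.append (σfs I) (fs J))
  let Z : ι → ι → ℂ := fun I J => (pullback S₁ R).osPairing (P I) (P J)
  -- (1) entry convergence
  have hentry : ∀ I J, Tendsto (fun k => ((M k I J : ℝ) : ℂ)) atTop (𝓝 (Z I J)) := by
    intro I J
    let g : Fin (deg I + deg J) → 𝓢(E4, ℝ) := Fin.append (fun i => thetaTest 4 (f I (Fin.rev i))) (f J)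
    let gR : Fin (deg I + deg J) → 𝓢(E4, ℝ) := fun p => linActTest R (g p)
    have hTg : IsTensorOf ((osAdjoint (P I)).appendTensor (P J)) fun p => ofRealTest (g p) :=
      isTensorOf_osAdjoint_appendTensor (hT I) (hT J)
    have hTgR : IsTensorOf (linActMulti R ((osAdjoint (P I)).appendTensor (P J))) fun p => ofRealTest (gR p) :=
      hTg.linActMulti R
    obtain ⟨LO, HI, -, hord', hsupp'⟩ :=
      append_slabs (hlo I) (hle I) (hord I) (hsupp I) (hlo J) (hle J) (hord J) (hsupp J)
    have hoffR : IsOffDiagonal (linActMulti R ((osAdjoint (P I)).appendTensor (P J))) :=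
      isOffDiagonal_linActMulti (isOffDiagonal_of_slabs hTg hord' hsupp') R
    have hgR : Fin.append (σfs I) (fs J) = gR := by
      funext p
      induction p using Fin.addCases with
      | left l => simp only [Fin.append_left, gR, g, σfs]
      | right l => simp only [Fin.append_right, gR, g, fs]
    show Tendsto (fun k => ((latticeSchwinger r.ρ sch (fun s => s.F) k (deg I + deg J) (fun _ => r.curvature)
      (Fin.append (σfs I) (fs J)) : ℝ) : ℂ)) atTop
      (𝓝 (S₁ (deg I + deg J) (linActMulti R ((osAdjoint (P I)).appendTensor (P J)))))
    rw [hgR]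
    by_cases hn : deg I + deg J = 0
    · -- degree zero: both sides are `1`
      haveI : IsEmpty (Fin (deg I + deg J)) := by rw [hn]; infer_instance
      have hlim : S₁ (deg I + deg J) (linActMulti R ((osAdjoint (P I)).appendTensor (P J))) = 1 := by
        have hgen : ∀ {m : ℕ} (hm : m = 0) (F : 𝓢((Fin m → E4), ℂ)) (x : Fin m → E4), S₁ m F = F x := by
          intro m hm F x
          subst hm
          exact (hE0 (fun _ => ()) F).trans (congrArg F (Subsingleton.elim _ _))
        rw [hgen hn _ (fun _ => 0), hTgR]
        simp
      have hlat : ∀ k, latticeSchwinger r.ρ sch (fun s => s.F) k (deg I + deg J) (fun _ => r.curvature) gR = 1 := by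
        intro k
        haveI := isProbabilityMeasure_wilsonMeasure (d := 4) (L := sch.side k) (G := G) r.ρ r.continuous (sch.β k)
        simp [latticeSchwinger]
      simp only [hlim, hlat, Complex.ofReal_one]
      exact tendsto_const_nhds
    · exact hconv _ hn gR _ hTgR hoffR
  -- (2) the limit matrix is real …
  have hZim : ∀ I J, (Z I J).im = 0 := fun I J =>
    (isClosed_eq Complex.continuous_im continuous_const).mem_of_tendsto (hentry I J)
      (Eventually.of_forall fun k => Complex.ofReal_im _)
  have hZreal : ∀ I J, (((Z I J).re : ℝ) : ℂ) = Z I J := fun I J =>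
    Complex.ext (by simp) (by simp [hZim I J])
  have hentryRe : ∀ I J, Tendsto (fun k => M k I J) atTop (𝓝 (Z I J).re) := by
    intro I J
    have h := (Complex.continuous_re.tendsto _).comp (hentry I J)
    simp only [Function.comp_def, Complex.ofReal_re] at h
    exact h
  -- … and symmetric (lattice symmetry at every `k`, §1)
  have hMsymm : ∀ k I J, M k I J = M k J I := fun k I J =>
    latticeSchwinger_append_mirror_symm r sch k (fs I) (σfs I) (fs J) (σfs J) (hmirror I) (hmirror J)
  have hZsymm : ∀ I J, (Z I J).re = (Z J I).re := fun I J =>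
    tendsto_nhds_unique (hentryRe I J) (by simpa only [hMsymm] using hentryRe J I)
  -- (3) the socket: the real quadratic form of the limit matrix is non-negative
  have hq : ∀ x : ι → ℝ, 0 ≤ ∑ I, ∑ J, x I * x J * (Z I J).re := by
    intro x
    let e := Fintype.equivFin ι
    have hlim : Tendsto (fun k => ∑ I, ∑ J, x I * x J * M k I J) atTop (𝓝 (∑ I, ∑ J, x I * x J * (Z I J).re)) :=
      tendsto_finsetSum _ fun I _ => tendsto_finsetSum _ fun J _ => (hentryRe I J).const_mul _
    have hre : ∀ k, (∑ i, ∑ i', x (e.symm i) * x (e.symm i') * M k (e.symm i) (e.symm i')) =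
        ∑ I, ∑ J, x I * x J * M k I J := fun k =>
      calc (∑ i, ∑ i', x (e.symm i) * x (e.symm i') * M k (e.symm i) (e.symm i'))
          = ∑ i, ∑ J, x (e.symm i) * x J * M k (e.symm i) J :=
            Finset.sum_congr rfl fun i _ => Equiv.sum_comp e.symm (fun J => x (e.symm i) * x J * M k (e.symm i) J)
        _ = ∑ I, ∑ J, x I * x J * M k I J := Equiv.sum_comp e.symm (fun I => ∑ J, x I * x J * M k I J)
    have hsock' := hsock (Fintype.card ι) (fun i => deg (e.symm i)) (fun i => x (e.symm i))
      (fun i l => fs (e.symm i) l) (fun i l => σfs (e.symm i) l)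
      (fun i l => ⟨hasCompactSupport_linActTest (hcs _ _) R, hhalf _ _⟩)
      (fun i l l' hll' => hdisj _ l l' hll') (fun i l x => hmirror _ l x)
    have hlim' : Tendsto (fun k => ∑ i, ∑ i', x (e.symm i) * x (e.symm i') * M k (e.symm i) (e.symm i')) atTop
        (𝓝 (∑ I, ∑ J, x I * x J * (Z I J).re)) := by
      simp only [hre]
      exact hlim
    have hkey : 0 ≤ Filter.liminf (fun k => ∑ i, ∑ i', x (e.symm i) * x (e.symm i') * M k (e.symm i) (e.symm i'))
        atTop := hsock'
    rwa [hlim'.liminf_eq] at hkey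
  -- (4) assembling: `z = q(Re c) + q(Im c) + i · 0`
  let a : ι → ℝ := fun I => (coef I).re
  let b : ι → ℝ := fun I => (coef I).im
  have e1 : ∀ I J, (conj (coef I) * coef J).re = a I * a J + b I * b J := fun I J => by
    simp only [Complex.mul_re, Complex.conj_re, Complex.conj_im, a, b]
    ring
  have e2 : ∀ I J, (conj (coef I) * coef J).im = a I * b J - b I * a J := fun I J => by
    simp only [Complex.mul_im, Complex.conj_re, Complex.conj_im, a, b]
    ring
  have hzre : z.re = ∑ I, ∑ J, (a I * a J + b I * b J) * (Z I J).re := by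
    simp only [z, Complex.re_sum]
    refine Finset.sum_congr rfl fun I _ => Finset.sum_congr rfl fun J _ => ?_
    rw [Complex.mul_re, e1, hZim I J, mul_zero, sub_zero]
  have hzim : z.im = ∑ I, ∑ J, (a I * b J - b I * a J) * (Z I J).re := by
    simp only [z, Complex.im_sum]
    refine Finset.sum_congr rfl fun I _ => Finset.sum_congr rfl fun J _ => ?_
    rw [Complex.mul_im, e1, e2, hZim I J, mul_zero, zero_add]
  refine ⟨?_, ?_⟩
  · rw [hzre]
    simp only [add_mul, Finset.sum_add_distrib]
    exact add_nonneg (hq a) (hq b)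
  · rw [hzim]
    simp only [sub_mul, Finset.sum_sub_distrib]
    rw [sub_eq_zero]
    conv_rhs => rw [Finset.sum_comm]
    refine Finset.sum_congr rfl fun I _ => Finset.sum_congr rfl fun J _ => ?_
    rw [hZsymm J I]
    ring

end PSD

end RpClosure

end Summit.QuantumFields.YangMills.Cruxes.DiagonalMirrorRPR.ParityBridgeColdTraces

end
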